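import Mathlib
import Literature.Analysis.FluidPDE.ClassicalSolution
import Literature.Analysis.FluidPDE.VectorCalculus
import Literature.Analysis.FluidPDE.AncientMildDrift
import Summits.NavierStokesRegularity.NavierStokesRegularity.Theorems.ThreadingFluxHorizonTowerDefs
import HarnessLib

/-!
# Crux `PoloidalLiouville` (stmt-NavierStokesRegularity-1222, wall W1), crux idea «horizon-threading-tower» (ns-idea-15):
# the sketch v4 SCOPE-GAP Prop `ScaleFreeFarField` is FALSE AS TYPED (Galilean / pressure gauge)

NEGATIVE KNOWLEDGE about a sketch Prop — not a ledger refutation; no route breaks.  The SCOPE-GAP Prop `ScaleFreeFarField` of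
`Cruxes/PoloidalLiouville/HorizonTowerSketch.lean` v4 (custodian ns-idea-15 g8; director-ns ruling (3) 2026-08-29T04:09:29Z) is
**refuted AS TYPED by the accelerated rest frame (gauge); sketch v5 re-types it gauge-fixed** (pressure clause modulo affine
functions, or gauge-fix first, or `p t` sublinear — the witness below misses all three repairs).

AUTHORSHIP: kernel file of the critic of record ns-wall-crit-1 g4 (`pub/ideators/ns-wall-crit-1/g4/GAP-ScaleFreeFarField-counterexample.lean`,
sha16 dfa3411a29d744dd, 2026-08-29T04:31:36Z), landed Theorems-side by ARM A (ns-exp-scalarLiouville g5) on director KEY 04:32:46Z (α),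
VERBATIM up to (i) the witness direction `e_x` becoming a parameter `w` of the helper lemmas and a `set` in the main proof (no
definitions in a proof file) and (ii) the Prop body being inlined in the statement of `not_scaleFreeFarField` (the Cruxes sketch is
not importable here); the inlined body is the v4 text VERBATIM over the Defs-of-record names (`HorizonTower.E3`,
`IsZeroHomogeneousAbout`, `IsBlowdownLimit` of `ThreadingFluxHorizonTowerDefs`).

Witness: the accelerated rest frame on `(−∞, 0)`, `v(t,y) = −(1/(1−t) − 1) w`, `p(t,y) = (1−t)⁻²⟪w, y⟫` (`‖w‖ = 1`; the `Iio 0`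
twin of the tree's `isClassicalNSSolutionOn_acceleratedRest`, `Literature/Analysis/FluidPDE/PeriodicGalileanFrameBlowup.lean`) is a
bounded ancient mild solution (`isBoundedAncientMildSolution_timeConst`), classical on `(−∞,0)`, unthreaded about `0` (`curl ≡ 0`), and
its slice at `t₀ = −1` has NO blow-down limit in the sense of `IsBlowdownLimit`: the `j = 0` pressure clause fails on the two-point
compact `{w, −w}` (the rescaled pressures differ there by `λₖ/2 → ∞`).

HONEST LABEL: 1222 `PoloidalLiouville`, W1 and NS regularity remain OPEN; nothing here is an NS regularity statement.
`--supports stmt-NavierStokesRegularity-1222 --as helper`.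
-/

noncomputable section

-- the summit and its single sub-problem share the name (CONVENTIONS §1)
set_option linter.dupNamespace false

namespace Summit.NavierStokesRegularity.NavierStokesRegularity.Theorems.PoloidalLiouville.HorizonTower.ScopeGap

open Set Function Filter InnerProductSpace MeasureTheory
open scoped ContDiff RealInnerProductSpace Topology Laplacian
open Literature.Analysis.FluidPDE
open Summit.NavierStokesRegularity.NavierStokesRegularity.Theorems.PoloidalLiouville.HorizonTower

/-- The frame speed `1/(1−t) − 1` has derivative `(1−t)⁻²` away from `t = 1`. [folklore] -/
theorem hasDerivAt_frameSpeed {t : ℝ} (ht : t ≠ 1) :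
    HasDerivAt (fun s : ℝ => 1 / (1 - s) - 1) (1 / (1 - t) ^ 2) t := by
  have h1 : HasDerivAt (fun s : ℝ => 1 - s) (-1) t := (hasDerivAt_id' t).const_sub 1
  have h3 : HasDerivAt (fun s : ℝ => (1 - s)⁻¹ - 1) (-(-1) / (1 - t) ^ 2) t :=
    (h1.inv (sub_ne_zero.2 (Ne.symm ht))).sub_const 1
  simp only [one_div]
  exact h3.congr_deriv (by ring)

/-- Velocity bound of the accelerated rest frame on `(−∞, 0)`: `‖−(1/(1−t) − 1) w‖ ≤ 1` for a unit `w`. [folklore] -/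
theorem norm_accelVel_le {w : E3} (hw : ‖w‖ = 1) {t : ℝ} (ht : t < 0) : ‖-(1 / (1 - t) - 1) • w‖ ≤ 1 := by
  have h1 : (0 : ℝ) < 1 - t := by linarith
  have h2 : 0 < 1 / (1 - t) := by positivity
  have h3 : 1 / (1 - t) < 1 := by rw [div_lt_one h1]; linarith
  rw [norm_smul, norm_neg, hw, mul_one, Real.norm_eq_abs, abs_le]
  constructor <;> linarith

/-- **The accelerated rest frame on `(−∞, 0)`** is a classical unforced NS solution (the `Iio 0` twin of the tree's
`isClassicalNSSolutionOn_acceleratedRest`, `PeriodicGalileanFrameBlowup.lean`). [folklore] -/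
theorem isClassicalNSSolutionOn_acceleratedRest_Iio (w : E3) :
    IsClassicalNSSolutionOn (E := E3) (Iio 0) 1 0 (fun t (_ : E3) => -(1 / (1 - t) - 1) • w)
      (fun t y => (1 / (1 - t) ^ 2) * ⟪w, y⟫) where
  smooth_velocity := by
    have h : ContDiffOn ℝ ∞ (fun z : ℝ × E3 => -(1 / (1 - z.1) - 1) • w) (Iio 0 ×ˢ univ) := by
      refine ((ContDiffOn.sub ?_ (contDiffOn_const (c := (1 : ℝ)))).neg).smul contDiffOn_const
      simp only [one_div]
      exact (contDiffOn_const.sub contDiff_fst.contDiffOn).inv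
        fun z hz => sub_ne_zero.2 (ne_of_gt (lt_trans (show z.1 < 0 from hz.1) zero_lt_one))
    exact h
  smooth_pressure := by
    have h : ContDiffOn ℝ ∞ (fun z : ℝ × E3 => (1 / (1 - z.1) ^ 2) * ⟪w, z.2⟫) (Iio 0 ×ˢ univ) := by
      refine ContDiffOn.mul ?_ (contDiff_const.inner ℝ contDiff_snd).contDiffOn
      simp only [one_div]
      exact ((contDiffOn_const.sub contDiff_fst.contDiffOn).pow 2).inv
        fun z hz => pow_ne_zero 2 (sub_ne_zero.2 (ne_of_gt (lt_trans (show z.1 < 0 from hz.1) zero_lt_one)))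
    exact h
  momentum t ht y := by
    have ht1 : t ≠ 1 := ne_of_lt (lt_trans (show t < 0 from ht) zero_lt_one)
    have hT : timeDerivWithin (Iio 0) (fun s (_ : E3) => -(1 / (1 - s) - 1) • w) t y =
        -(1 / (1 - t) ^ 2) • w := by
      rw [timeDerivWithin_apply]
      exact (((hasDerivAt_frameSpeed ht1).neg).smul_const w).hasDerivWithinAt.derivWithin
        (uniqueDiffOn_Iio 0 t ht)
    have hC : convect ((fun s (_ : E3) => -(1 / (1 - s) - 1) • w) t)
        ((fun s (_ : E3) => -(1 / (1 - s) - 1) • w) t) y = 0 := by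
      simp only [convect_apply]
      rw [fderiv_const_apply]
      simp
    have hL : Δ ((fun s (_ : E3) => -(1 / (1 - s) - 1) • w) t) y = 0 := by
      show Δ (fun _ : E3 => -(1 / (1 - t) - 1) • w) y = 0
      rw [InnerProductSpace.laplacian_const]
      rfl
    have hG : gradient ((fun s z => (1 / (1 - s) ^ 2) * ⟪w, z⟫) t) y = (1 / (1 - t) ^ 2) • w := by
      show gradient (fun z : E3 => (1 / (1 - t) ^ 2) * ⟪w, z⟫) y = _
      have h1 : HasFDerivAt (fun z : E3 => ⟪w, z⟫) (toDual ℝ E3 w) y := by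
        have : (fun z : E3 => ⟪w, z⟫) = toDual ℝ E3 w := by funext z; rfl
        rw [this]; exact (toDual ℝ E3 w).hasFDerivAt
      have h2 := h1.const_mul (1 / (1 - t) ^ 2)
      unfold gradient
      rw [h2.fderiv, map_smul, LinearIsometryEquiv.symm_apply_apply]
    rw [hT, hC, hL, hG]
    simp
  divFree t _ y := by
    change VectorCalculus.divergence (fun _ : E3 => -(1 / (1 - t) - 1) • w) y = 0
    unfold VectorCalculus.divergence
    rw [fderiv_const_apply]
    simp

/-- ★ **The SCOPE GAP `ScaleFreeFarField` (HorizonTowerSketch v4) is false AS TYPED.**  The negated statement is the v4 Prop body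
VERBATIM over the Defs-of-record names; the witness is the accelerated rest frame (a Galilean / pressure-gauge artefact — v5 re-types
the gap gauge-fixed).  Critic ns-wall-crit-1 g4's kernel proof, landed by ARM A. [folklore] -/
theorem not_scaleFreeFarField :
    ¬ (∀ (v : ℝ → E3 → E3) (p : ℝ → E3 → ℝ) (x₀ : E3),
        Literature.Analysis.FluidPDE.IsBoundedAncientMildSolution 1 v →
        Literature.Analysis.FluidPDE.IsClassicalNSSolutionOn (Set.Iio 0) 1 0 v p →
        (∀ t < 0, ∀ x, inner ℝ (x - x₀) (curl (v t) x) = 0) →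
        ∀ t₀ < 0, ∃ (U : E3 → E3) (P₀ : E3 → ℝ) (s₀ : ℝ),
          IsZeroHomogeneousAbout 0 U ∧ (∀ c : ℝ, 0 < c → ∀ y : E3, P₀ (c • y) = P₀ y) ∧
          ContDiffOn ℝ 6 U ({0}ᶜ : Set E3) ∧ ContDiffOn ℝ 2 P₀ ({0}ᶜ : Set E3) ∧
          IsBlowdownLimit (v t₀) (p t₀) x₀ U (fun y : E3 => P₀ y + s₀ * Real.log ‖y‖)) := by
  intro h
  set eX : E3 := EuclideanSpace.single 0 1 with heX
  have norm_eX : ‖eX‖ = 1 := by simp [heX]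
  have eX_ne_zero : eX ≠ 0 := by
    intro h0
    rw [h0, norm_zero] at norm_eX
    exact zero_ne_one norm_eX
  have hB : IsBoundedAncientMildSolution 1 (fun t (_ : E3) => -(1 / (1 - t) - 1) • eX) :=
    isBoundedAncientMildSolution_timeConst (E := E3) 1 ⟨1, fun t ht => norm_accelVel_le norm_eX ht⟩
  have hun : ∀ t < (0 : ℝ), ∀ x : E3,
      inner ℝ (x - 0) (curl ((fun t (_ : E3) => -(1 / (1 - t) - 1) • eX) t) x) = 0 := by
    intro t _ x
    have hc : curl (fun _ : E3 => -(1 / (1 - t) - 1) • eX) x = 0 := by simp [curl]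
    show inner ℝ (x - 0) (curl (fun _ : E3 => -(1 / (1 - t) - 1) • eX) x) = 0
    rw [hc]
    simp
  obtain ⟨U, P₀, s₀, -, -, -, -, lam, c, hlam, -, hp⟩ :=
    h _ _ 0 hB (isClassicalNSSolutionOn_acceleratedRest_Iio eX) hun (-1) (by norm_num)
  have hK : IsCompact ({eX, -eX} : Set E3) := (Set.toFinite _).isCompact
  have h0 : (0 : E3) ∉ ({eX, -eX} : Set E3) := by
    simp only [mem_insert_iff, mem_singleton_iff, not_or]
    exact ⟨fun h => eX_ne_zero h.symm, fun h => eX_ne_zero (neg_eq_zero.1 h.symm)⟩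
  have hT := hp {eX, -eX} hK h0 0 (by norm_num)
  simp only [image_pair, csSup_pair, norm_iteratedFDeriv_zero] at hT
  have hev := hT.eventually (gt_mem_nhds one_pos)
  obtain ⟨k, hk1, hk2⟩ := (hev.and (hlam.eventually_ge_atTop (4 * (2 + |P₀ eX - P₀ (-eX)|) + 4))).exists
  rw [sup_lt_iff] at hk1
  obtain ⟨h1, h2⟩ := hk1
  simp only [zero_add, inner_smul_right, inner_neg_right, real_inner_self_eq_norm_sq, norm_eX, norm_neg,
    Real.log_one, mul_zero, add_zero, Real.norm_eq_abs] at h1 h2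
  rw [abs_lt] at h1 h2
  have hD := le_abs_self (P₀ eX - P₀ (-eX))
  have hD' := neg_abs_le (P₀ eX - P₀ (-eX))
  norm_num at h1 h2
  obtain ⟨h1a, h1b⟩ := h1
  obtain ⟨h2a, h2b⟩ := h2
  nlinarith [h1a, h1b, h2a, h2b, hk2, hD, hD']

end Summit.NavierStokesRegularity.NavierStokesRegularity.Theorems.PoloidalLiouville.HorizonTower.ScopeGap

end
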